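import Summits.QuantumAdvantage.QuantumAdvantage.Theorems.CubicForrelationNearExactIsExactTwelveDigitSubspace
import Summits.QuantumAdvantage.QuantumAdvantage.Theorems.NearExactIsExact.Negative.XorSpanAvoid

/-!
# Crux `CubicForrelation.NearExactIsExact` (stmt-QuantumAdvantage-14043) — n = 12: E1280 from AT MOST 126 LIGHT DIRECTIONS (Bose–Burton)

Certificate seat `b2b-cforr-cert` (gen 34).  HONEST FRAMING: a kernel-checked counting lemma (standard axioms) about Boolean functions on
12 bits, combining …TwelveDigitSubspace (one 6-dimensional subspace of directions without light derivatives ⇒ `e ≥ 1286`) with the greedy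
Bose–Burton lemma `XorSpanAvoid.exists_lcomb_avoiding` already in the tree.  It closes nothing by itself and is NOT summit progress.

* `tdbb_weight_window_of_few_light` : for any Boolean `κ` on 12 bits, if the set `N` of non-zero directions `a` whose derivative `D_aκ` has
  fewer than `1792` ones satisfies `#N ≤ 126`, then `1286 ≤ #{κ = 1} ≤ 2810`; `tdbb_e_ge_1288_of_few_light`: with `8 ∣ e`, `e ≥ 1288`.
USE (paper, HOME/b2b-cforr-cert-g34/PLAN-N12-LOWRANK.md §12): for the digit class of a type-O cubic `g` on 12 bits the light directions are
among those of slice rank `≤ 4` of the matching dual `C*` (`tdq_frame_card`), so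
  `E1280 (⇒ θ₁₂ = 57/64)  ⟸  N₂(C*) + N₄(C*) ≤ 126 for every type-O C with #PM(C*) even`
(observed `≤ 84` over 651 069 even duals, kit j212619; the odd case is THEOREM W).  Compare …TwelveDigitLowRank (`3N₂ + N₄ ≤ 601`).

References: R. C. Bose, R. C. Burton, *A characterization of flat spaces in a finite geometry and the uniqueness of the Hamming and the
MacDonald codes*, J. Combin. Theory 1 (1966) 96–104, Thm. 1.  Axioms: the standard three.
-/

set_option linter.dupNamespace false -- D-0017: single-problem summit ⇒ `QuantumAdvantage.QuantumAdvantage` by design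

noncomputable section

namespace Summit.QuantumAdvantage.QuantumAdvantage.Theorems.CubicForrelation.NearExactIsExact

open Finset
open Literature.Computability.QuantumComplexity
open Literature.Computability.QuantumComplexity.BuzetChailloux (bxor zeroVec bxor_zeroVec bxor_bxor_cancel_left)
open Summit.QuantumAdvantage.QuantumAdvantage.Theorems.NearExactIsExact.Negative.XorSpanAvoid (lcomb lcomb_succ exists_lcomb_avoiding)

section BoseBurton

variable {k : ℕ}

/-- The trivial combination is zero: `lcomb j v 0 = 0`. -/
theorem tdbb_lcomb_zero : ∀ (j : ℕ) (v : Fin j → (Fin k → Bool)), lcomb j v (fun _ => false) = zeroVec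
  | 0, _ => rfl
  | j + 1, v => by
    rw [lcomb_succ]
    have ht : Fin.tail (fun _ : Fin (j + 1) => false) = fun _ : Fin j => false := rfl
    rw [ht, tdbb_lcomb_zero j (Fin.tail v)]
    funext x
    simp [bxor, zeroVec]

/-- `lcomb` is additive in the coefficient vector: `Σ (sᵢ ⊕ s′ᵢ) vᵢ = (Σ sᵢvᵢ) ⊕ (Σ s′ᵢvᵢ)`. -/
theorem tdbb_lcomb_add : ∀ (j : ℕ) (v : Fin j → (Fin k → Bool)) (s s' : Fin j → Bool),
    lcomb j v (fun i => s i ^^ s' i) = bxor (lcomb j v s) (lcomb j v s')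
  | 0, _, _, _ => by funext x; simp [lcomb, bxor, zeroVec]
  | j + 1, v, s, s' => by
    rw [lcomb_succ, lcomb_succ, lcomb_succ]
    have ht : Fin.tail (fun i : Fin (j + 1) => s i ^^ s' i) = fun i : Fin j => Fin.tail s i ^^ Fin.tail s' i := rfl
    rw [ht, tdbb_lcomb_add j (Fin.tail v) (Fin.tail s) (Fin.tail s')]
    funext x
    simp only [bxor]
    cases lcomb j (Fin.tail v) (Fin.tail s) x <;> cases lcomb j (Fin.tail v) (Fin.tail s') x <;>
      cases s 0 <;> cases s' 0 <;> cases v 0 x <;> rfl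

/-- **E1280 from at most 126 light directions (Bose–Burton localisation).**  If at most `126` non-zero directions `a` have
`#{x : κ x ≠ κ(x ⊕ a)} < 1792`, then `1286 ≤ #{κ = 1} ≤ 2810`: the greedy Bose–Burton lemma gives six independent directions all of whose
non-trivial combinations avoid the light set, and `tdls_weight_window_of_subspace` applies to their span. [this work] -/
theorem tdbb_weight_window_of_few_light (κ : (Fin (6 + 6) → Bool) → Bool) (N : Finset (Fin (6 + 6) → Bool))
    (hN : ∀ a : Fin (6 + 6) → Bool, a ≠ zeroVec → a ∉ N →
      1792 ≤ #(univ.filter fun x : Fin (6 + 6) → Bool => (κ x ^^ κ (bxor x a)) = true))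
    (hcard : #N ≤ 126) :
    1286 ≤ #(univ.filter fun x : Fin (6 + 6) → Bool => κ x = true) ∧
      #(univ.filter fun x : Fin (6 + 6) → Bool => κ x = true) ≤ 2810 := by
  classical
  have hbound : (#N + 1) * 2 ^ 6 < 2 ^ (6 + 6 + 1) := by
    have : #N + 1 ≤ 127 := by omega
    calc (#N + 1) * 2 ^ 6 ≤ 127 * 2 ^ 6 := Nat.mul_le_mul_right _ this
      _ < 2 ^ (6 + 6 + 1) := by norm_num
  obtain ⟨v, hv⟩ := exists_lcomb_avoiding N 6 hbound
  set L : (Fin 6 → Bool) → (Fin (6 + 6) → Bool) := lcomb 6 v with hL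
  -- injectivity of `L`
  have hinj : Function.Injective L := by
    intro s s' hss'
    by_contra hne
    have hd : (fun i => s i ^^ s' i) ≠ (fun _ => false) := by
      intro h0
      apply hne
      funext i
      have hi := congrFun h0 i
      revert hi; cases s i <;> cases s' i <;> simp
    have h1 := (hv _ hd).1
    apply h1
    show lcomb 6 v (fun i => s i ^^ s' i) = zeroVec
    have hss : lcomb 6 v s = lcomb 6 v s' := hss'
    rw [tdbb_lcomb_add 6 v s s', hss]
    funext x; simp [bxor, zeroVec]
  set V : Finset (Fin (6 + 6) → Bool) := univ.image L with hVdef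
  have h0 : zeroVec ∈ V := mem_image.2 ⟨fun _ => false, mem_univ _, tdbb_lcomb_zero 6 v⟩
  have hX : ∀ x ∈ V, ∀ y ∈ V, bxor x y ∈ V := by
    intro x hx y hy
    obtain ⟨s, -, rfl⟩ := mem_image.1 hx
    obtain ⟨s', -, rfl⟩ := mem_image.1 hy
    exact mem_image.2 ⟨fun i => s i ^^ s' i, mem_univ _, (tdbb_lcomb_add 6 v s s').trans rfl⟩
  have hVcard : #V = 64 := by
    rw [hVdef, card_image_of_injective _ hinj, card_univ, Fintype.card_fun, Fintype.card_bool, Fintype.card_fin]; norm_num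
  have h6 : ∀ a ∈ V, a ≠ zeroVec → 1792 ≤ #(univ.filter fun x : Fin (6 + 6) → Bool => (κ x ^^ κ (bxor x a)) = true) := by
    intro a ha hne
    obtain ⟨s, -, rfl⟩ := mem_image.1 ha
    have hs : s ≠ (fun _ => false) := by
      intro h; apply hne; rw [h]; exact tdbb_lcomb_zero 6 v
    exact hN _ hne (hv s hs).2
  exact tdls_weight_window_of_subspace κ V h0 hX hVcard h6

/-- With `8 ∣ e` (a cubic support on 12 bits): at most 126 light directions force `e ≥ 1288`. [this work] -/
theorem tdbb_e_ge_1288_of_few_light (κ : (Fin (6 + 6) → Bool) → Bool) (N : Finset (Fin (6 + 6) → Bool))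
    (hN : ∀ a : Fin (6 + 6) → Bool, a ≠ zeroVec → a ∉ N →
      1792 ≤ #(univ.filter fun x : Fin (6 + 6) → Bool => (κ x ^^ κ (bxor x a)) = true))
    (hcard : #N ≤ 126) (h8 : 8 ∣ #(univ.filter fun x : Fin (6 + 6) → Bool => κ x = true)) :
    1288 ≤ #(univ.filter fun x : Fin (6 + 6) → Bool => κ x = true) := by
  have h := (tdbb_weight_window_of_few_light κ N hN hcard).1
  omega

end BoseBurton

end Summit.QuantumAdvantage.QuantumAdvantage.Theorems.CubicForrelation.NearExactIsExact

end
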